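import Summits.Langlands.Langlands.Theorems.IrreducibilityBySelfDualityIrreducibleOffSectorBaseChangeAscent
import Summits.Langlands.Langlands.Theorems.IrreducibilityBySelfDualityIrreducibleOffSectorSelfTwistSatake
import Summits.Langlands.Langlands.Theorems.IrreducibilityBySelfDualityIrreducibleOffSectorSplitPlaceOfFrobenius
import Literature.NumberTheory.Automorphic.LanglandsTetrahedral
import Literature.NumberTheory.GaloisRepresentations.IntegralGaloisActionProofs
import HarnessLib

/-!
# Base-change ascent in prime degree: a Satake-level criterion for the absence of self-twists
(crux stmt-Langlands-14329 `IrreducibilityBySelfDuality.IrreducibleOffSector`, line `Sketch`;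
`--supports` file, STRUCTURAL: no import of the route module; continuation lead c7)

The ascent operator `isIrreducible_of_isWeakBaseChangeLiftAE_ascent` (`…BaseChangeAscent`) needs an
avatar `ρ₀` of `π` over `K` admitting no self-twist `ρ₀ ≅ ρ₀ ⊗ χ` by the non-trivial characters
`χ` of `Gal(L/K)`.  For `[L:K] = p` PRIME this Galois condition follows from a purely AUTOMORPHIC,
local one on the Satake parameters of `π` (`no_selfTwist_of_frequently_nonsplit`): it suffices that
at infinitely many finite places `v` of `K` that are NOT split in `L` (no place of `L` above `v` has
residue degree one) the Satake multiset `α_v` of `π` is not invariant under multiplication by a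
non-trivial `p`-th root of unity.  Indeed a self-twist forces, at almost every `v`, invariance of
`α_v` under `ι(χ(Frob_v))⁻¹` (`satake_map_mul_eq_of_equiv_twist`, p-pending), and `χ(Frob_v) ≠ 1`
exactly when `Frob_v ∉ res(Γ_L) = ker χ` (prime index), i.e. when `v` is not split in `L`
(`exists_place_inertiaDeg_eq_one_of_isArithFrobAt_mem_range`, p127878: a Frobenius inside
`res(Γ_L)` produces a degree-one place).  Consequences:

* `isIrreducible_of_isWeakBaseChangeLiftAE_prime` — `[L:K] = p` prime (so `L/K` cyclic), `Π` a weak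
  base-change lift of `π`, `ρ₀` an irreducible avatar of `π`, and the Satake condition above ⟹ every
  `ρ'` a.e.-compatible with `(Π, ι)` is irreducible;
* `irreducibleOffSector_conclusion_ascent_prime` — the same with "irreducible avatar" replaced by
  the crux's conclusion for `π` over `K` plus one avatar (binder shape).

For `n = 2`, `p = 2` the Satake condition reads "`a_v(π) ≠ 0` (i.e. `α_v ≠ {a, −a}`) at infinitely
many places `v` inert in `L`", the classical criterion for `π` not to be dihedral with respect to
`L` (Ribet 1977 §4; Langlands, *Base change for GL(2)*, §2).

References: J. Arthur, L. Clozel, *Simple algebras, base change, and the advanced theory of the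
trace formula* (1989), Ch. 3, Thm. 4.2 and Lemma 6.3; K. Ribet, *Galois representations attached
to eigenforms with Nebentypus*, LNM 601 (1977), §4; D. A. Marcus, *Number Fields*, Ch. 4, Thm. 29.
-/

noncomputable section

-- `Summit.Langlands.Langlands.…` (summit = sub-problem name, D-0017 layout) trips `dupNamespace`.
set_option linter.dupNamespace false

open scoped NumberField Classical
open Filter IsDedekindDomain
open Literature.RepresentationTheory.Semisimple
open Literature.NumberTheory.Automorphic Literature.NumberTheory.GaloisRepresentations Field
open Summit.Langlands

namespace Summit.Langlands.Langlands.Theorems.IrreducibleOffSector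

section Kernel

variable {G : Type*} [Group G] {M : Type*} [CommGroup M]

/-- A non-trivial character that is trivial on a subgroup `H` of PRIME index has kernel exactly
`H`: `[G : ker χ]` divides `[G : H] = p` and is not `1`. [folklore] -/
theorem ker_eq_of_prime_index (χ : G →* M) {H : Subgroup G} (hp : H.index.Prime)
    (hH : ∀ g ∈ H, χ g = 1) (hχ : χ ≠ 1) : χ.ker = H := by
  have hle : H ≤ χ.ker := fun g hg => by rw [MonoidHom.mem_ker]; exact hH g hg
  have hdvd : χ.ker.index ∣ H.index := Subgroup.index_dvd_of_le hle
  rcases (Nat.dvd_prime hp).1 hdvd with h1 | hpi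
  · exact absurd (MonoidHom.ker_eq_top_iff.1 (Subgroup.index_eq_one.1 h1)) hχ
  · refine le_antisymm ?_ hle
    have hrel := Subgroup.relIndex_mul_index hle
    rw [hpi] at hrel
    have h1 : H.relIndex χ.ker = 1 := by
      have hp0 : H.index ≠ 0 := hp.ne_zero
      have := hrel
      nth_rewrite 2 [← one_mul H.index] at this
      exact Nat.eq_of_mul_eq_mul_right (Nat.pos_of_ne_zero hp0) this
    exact Subgroup.relIndex_eq_one.1 h1

end Kernel


section Trace

/-- A multiset invariant under multiplication by `ζ ≠ 1` has sum zero (`ζ Σ = Σ`); contrapositively,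
`Σ α ≠ 0` witnesses the Satake condition of `no_selfTwist_of_frequently_nonsplit` for EVERY `ζ ≠ 1`.
[folklore] -/
theorem Multiset.sum_eq_zero_of_map_mul_eq {R : Type*} [CommRing R] [IsDomain R] (α : Multiset R)
    {ζ : R} (hζ : ζ ≠ 1) (h : α.map (fun a => ζ * a) = α) : α.sum = 0 := by
  have h1 : ζ * α.sum = α.sum := by
    have h2 := Multiset.sum_map_mul_left (s := α) (a := ζ) (f := fun a => a)
    rw [Multiset.map_id', h] at h2
    exact h2.symm
  have h2 : (ζ - 1) * α.sum = 0 := by rw [sub_mul, one_mul, h1, sub_self]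
  rwa [mul_eq_zero, or_iff_right (sub_ne_zero.2 hζ)] at h2

end Trace

section Prime

/-- **No Galois self-twist from a Satake-level condition (prime degree).**  Let `[L:K] = p` be
prime, `ρ : Γ_K → GL_n(ℚ̄_ℓ)` Satake–Frobenius compatible with `(π, ι)` at almost all places, and
suppose that at infinitely many finite places `v` of `K` NOT split in `L` (no place of `L` above
`v` of residue degree one) every Satake parameter `α` of `π` at `v` fails to be invariant under
multiplication by any `ζ ≠ 1` with `ζ ^ p = 1`.  Then `ρ` admits no self-twist `ρ ≅ ρ ⊗ χ` by a
non-trivial character `χ` of `Γ_K` trivial on `res(Γ_L)`.  Proof: such a `χ` has `ker χ = res(Γ_L)`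
(index `p`) and `χ ^ p = 1`; at a good non-split `v` with Frobenius `σ`, `σ ∉ res(Γ_L)` (else a
degree-one place exists), so `c = χ(σ) ≠ 1`, `c ^ p = 1`, and the self-twist makes `α` invariant
under `ι(c)⁻¹` (`satake_map_mul_eq_of_equiv_twist`) — a non-trivial `p`-th root of unity.
[cite: ArthurClozelAMS120, Ch. 3, Thm. 4.2 and Lemma 6.3] -/
theorem no_selfTwist_of_frequently_nonsplit {K : Type} [Field K] [NumberField K] {L : Type} [Field L]
    [NumberField L] [Algebra K L] [IsGalois K L] {ℓ : ℕ} [Fact ℓ.Prime] {n : ℕ}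
    {hK : isCompact_glFiniteIntegralLevel n K} (hp : (Module.finrank K L).Prime)
    (ι : PadicAlgCl ℓ ≃+* ℂ) (π : AutomorphicRepData (AutomorphyDatum.gl n K hK))
    (ρ : FramedGaloisRep K (PadicAlgCl ℓ) n)
    (hρ : ∀ᶠ v : HeightOneSpectrum (𝓞 K) in cofinite, SatakeFrobCompatibleAt ι π ρ v)
    (hns : ∃ᶠ v : HeightOneSpectrum (𝓞 K) in cofinite,
      (∀ w : HeightOneSpectrum (𝓞 L), w.asIdeal.under (𝓞 K) = v.asIdeal →
        w.asIdeal.inertiaDeg (𝓞 K) ≠ 1) ∧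
      ∀ α : Multiset ℂ, π.HasSatakeParamAt v α → ∀ ζ : ℂ, ζ ^ Module.finrank K L = 1 → ζ ≠ 1 →
        α.map (fun a => ζ * a) ≠ α)
    (χ : absoluteGaloisGroup K →* (PadicAlgCl ℓ)ˣ)
    (hχL : ∀ σ ∈ ((absGaloisRestrict K L).range : Subgroup (absoluteGaloisGroup K)), χ σ = 1)
    (hχ1 : χ ≠ 1) :
    IsEmpty ((FramedRep.toRepresentation ρ).Equiv
      (Representation.twist (FramedRep.toRepresentation ρ) χ)) := by
  refine ⟨fun e => ?_⟩
  set H : Subgroup (absoluteGaloisGroup K) := (absGaloisRestrict K L).range with hHdef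
  -- `H` is normal of index `p`, `ker χ = H`, `χ ^ p = 1`
  have hind : H.index = Module.finrank K L := (isOpen_range_absGaloisRestrict_and_index K L).2
  haveI : H.Normal := normal_range_absGaloisRestrict K L
  have hker : χ.ker = H := ker_eq_of_prime_index χ (hind ▸ hp) hχL hχ1
  have hpow : ∀ σ, χ σ ^ Module.finrank K L = 1 := fun σ => by
    rw [← map_pow, ← hind]
    exact hχL _ (Subgroup.pow_index_mem H σ)
  -- a good non-split place
  obtain ⟨v, ⟨hvns, hvα⟩, hvρ⟩ := (hns.and_eventually hρ).exists
  obtain ⟨α, hα, -, hcp⟩ := hvρ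
  obtain ⟨𝔓, h𝔓⟩ := HeightOneSpectrum.primesAbove_nonempty v
  obtain ⟨σ, hσ⟩ := HeightOneSpectrum.exists_isArithFrobAt_of_mem_primesAbove_holds h𝔓
  -- `σ ∉ H`, so `c = χ σ ≠ 1`
  have hσH : σ ∉ H := fun hmem => by
    obtain ⟨w, hw, hf⟩ := exists_place_inertiaDeg_eq_one_of_isArithFrobAt_mem_range h𝔓 hσ hmem
    exact hvns w hw hf
  have hc1 : (χ σ : PadicAlgCl ℓ) ≠ 1 := fun h1 => hσH (by
    rw [← hker, MonoidHom.mem_ker]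
    exact Units.val_eq_one.1 h1)
  -- the invariance forced by the self-twist, against the hypothesis at `v`
  have hinv := satake_map_mul_eq_of_equiv_twist ι ρ χ e hcp h𝔓 hσ
  refine hvα α hα (ι (χ σ : PadicAlgCl ℓ))⁻¹ ?_ ?_ hinv
  · rw [inv_pow, ← map_pow, ← Units.val_pow_eq_pow_val, hpow σ, Units.val_one, map_one, inv_one]
  · intro h1
    apply hc1
    have h2 : ι (χ σ : PadicAlgCl ℓ) = 1 := inv_injective (h1.trans inv_one.symm)
    exact ι.injective (h2.trans (map_one ι).symm)

/-- **Base-change ascent of irreducibility in prime degree, Satake form.**  Let `[L:K] = p` be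
prime (`L/K` Galois, hence cyclic), `Π` on `GL_n(𝔸_L)` a weak base-change lift of `π`
(`IsWeakBaseChangeLiftAE`), `ρ₀ : Γ_K → GL_n(ℚ̄_ℓ)` irreducible and Satake–Frobenius compatible with
`(π, ι)` at almost all places, and assume the Satake condition of
`no_selfTwist_of_frequently_nonsplit` (at infinitely many places of `K` not split in `L`, no Satake
parameter of `π` is invariant under a non-trivial `p`-th root of unity).  Then every
`ρ' : Γ_L → GL_n(ℚ̄_ℓ)` Satake–Frobenius compatible with `(Π, ι)` at almost all places is
irreducible. [cite: ArthurClozelAMS120, Ch. 3, Thm. 4.2 and Lemma 6.3] -/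
theorem isIrreducible_of_isWeakBaseChangeLiftAE_prime {K : Type} [Field K] [NumberField K] {L : Type} [Field L]
    [NumberField L] [Algebra K L] [IsGalois K L] {ℓ : ℕ} [Fact ℓ.Prime] {n : ℕ}
    {hK : isCompact_glFiniteIntegralLevel n K} {hL : isCompact_glFiniteIntegralLevel n L}
    (hp : (Module.finrank K L).Prime)
    (ι : PadicAlgCl ℓ ≃+* ℂ) (π : AutomorphicRepData (AutomorphyDatum.gl n K hK))
    (P : AutomorphicRepData (AutomorphyDatum.gl n L hL)) (hBC : IsWeakBaseChangeLiftAE π P)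
    (ρ₀ : FramedGaloisRep K (PadicAlgCl ℓ) n) (hirr₀ : ρ₀.toGaloisRep.IsIrreducible)
    (h₀ : ∀ᶠ v : HeightOneSpectrum (𝓞 K) in cofinite, SatakeFrobCompatibleAt ι π ρ₀ v)
    (hns : ∃ᶠ v : HeightOneSpectrum (𝓞 K) in cofinite,
      (∀ w : HeightOneSpectrum (𝓞 L), w.asIdeal.under (𝓞 K) = v.asIdeal →
        w.asIdeal.inertiaDeg (𝓞 K) ≠ 1) ∧
      ∀ α : Multiset ℂ, π.HasSatakeParamAt v α → ∀ ζ : ℂ, ζ ^ Module.finrank K L = 1 → ζ ≠ 1 →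
        α.map (fun a => ζ * a) ≠ α)
    (ρ' : FramedGaloisRep L (PadicAlgCl ℓ) n)
    (hρ' : ∀ᶠ w : HeightOneSpectrum (𝓞 L) in cofinite, SatakeFrobCompatibleAt ι P ρ' w) :
    ρ'.toGaloisRep.IsIrreducible :=
  haveI : Fact (Module.finrank K L).Prime := ⟨hp⟩
  isIrreducible_of_isWeakBaseChangeLiftAE_ascent
    (isCyclic_of_prime_card (α := L ≃ₐ[K] L) (p := Module.finrank K L)
      (IsGalois.card_aut_eq_finrank K L))
    ι π P hBC ρ₀ hirr₀ h₀ (no_selfTwist_of_frequently_nonsplit hp ι π ρ₀ h₀ hns) ρ' hρ'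

/-- **The crux ascends along base change of prime degree, Satake form (binder shape).**  GIVEN the
conclusion of `IrreducibleOffSector` for `π` on `GL_n(𝔸_K)` at `(ℓ, ι)` (`hIK`), ONE a.e.-compatible
avatar `ρ₀`, and the Satake condition (at infinitely many places of `K` not split in `L` no Satake
parameter of `π` is invariant under a non-trivial `p`-th root of unity, `p = [L:K]` prime), the
conclusion holds at `(ℓ, ι)` for every weak base-change lift `Π` of `π` to `L`.
[cite: ArthurClozelAMS120, Ch. 3, Thm. 4.2 and Lemma 6.3] -/
theorem irreducibleOffSector_conclusion_ascent_prime {K : Type} [Field K] [NumberField K] {L : Type} [Field L]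
    [NumberField L] [Algebra K L] [IsGalois K L] {ℓ : ℕ} [Fact ℓ.Prime] {n : ℕ}
    {hK : isCompact_glFiniteIntegralLevel n K} {hL : isCompact_glFiniteIntegralLevel n L}
    (hp : (Module.finrank K L).Prime)
    (ι : PadicAlgCl ℓ ≃+* ℂ) (π : AutomorphicRepData (AutomorphyDatum.gl n K hK))
    (hIK : ∀ ρ : FramedGaloisRep K (PadicAlgCl ℓ) n,
      (∀ᶠ v : HeightOneSpectrum (𝓞 K) in cofinite, SatakeFrobCompatibleAt ι π ρ v) →
        ρ.toGaloisRep.IsIrreducible)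
    (ρ₀ : FramedGaloisRep K (PadicAlgCl ℓ) n)
    (h₀ : ∀ᶠ v : HeightOneSpectrum (𝓞 K) in cofinite, SatakeFrobCompatibleAt ι π ρ₀ v)
    (hns : ∃ᶠ v : HeightOneSpectrum (𝓞 K) in cofinite,
      (∀ w : HeightOneSpectrum (𝓞 L), w.asIdeal.under (𝓞 K) = v.asIdeal →
        w.asIdeal.inertiaDeg (𝓞 K) ≠ 1) ∧
      ∀ α : Multiset ℂ, π.HasSatakeParamAt v α → ∀ ζ : ℂ, ζ ^ Module.finrank K L = 1 → ζ ≠ 1 →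
        α.map (fun a => ζ * a) ≠ α)
    (P : AutomorphicRepData (AutomorphyDatum.gl n L hL)) (hBC : IsWeakBaseChangeLiftAE π P)
    (ρ' : FramedGaloisRep L (PadicAlgCl ℓ) n)
    (hρ' : ∀ᶠ w : HeightOneSpectrum (𝓞 L) in cofinite, SatakeFrobCompatibleAt ι P ρ' w) :
    ρ'.toGaloisRep.IsIrreducible :=
  isIrreducible_of_isWeakBaseChangeLiftAE_prime hp ι π P hBC ρ₀ (hIK ρ₀ h₀) h₀ hns ρ' hρ'


/-- **Base-change ascent in prime degree, trace form.**  As `isIrreducible_of_isWeakBaseChangeLiftAE_prime`,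
with the Satake condition witnessed by NON-VANISHING TRACES: it suffices that at infinitely many
places `v` of `K` not split in `L` every Satake parameter `α` of `π` has `Σ α ≠ 0` (i.e. the Hecke
eigenvalue `a_v(π) ≠ 0`; `Multiset.sum_eq_zero_of_map_mul_eq`).  For `n = p = 2` this is the
classical "`a_v ≠ 0` at infinitely many places inert in `L`" excluding dihedral forms.
[cite: ArthurClozelAMS120, Ch. 3, Thm. 4.2 and Lemma 6.3] -/
theorem isIrreducible_of_isWeakBaseChangeLiftAE_prime_of_trace {K : Type} [Field K] [NumberField K]
    {L : Type} [Field L] [NumberField L] [Algebra K L] [IsGalois K L] {ℓ : ℕ} [Fact ℓ.Prime] {n : ℕ}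
    {hK : isCompact_glFiniteIntegralLevel n K} {hL : isCompact_glFiniteIntegralLevel n L}
    (hp : (Module.finrank K L).Prime)
    (ι : PadicAlgCl ℓ ≃+* ℂ) (π : AutomorphicRepData (AutomorphyDatum.gl n K hK))
    (P : AutomorphicRepData (AutomorphyDatum.gl n L hL)) (hBC : IsWeakBaseChangeLiftAE π P)
    (ρ₀ : FramedGaloisRep K (PadicAlgCl ℓ) n) (hirr₀ : ρ₀.toGaloisRep.IsIrreducible)
    (h₀ : ∀ᶠ v : HeightOneSpectrum (𝓞 K) in cofinite, SatakeFrobCompatibleAt ι π ρ₀ v)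
    (htr : ∃ᶠ v : HeightOneSpectrum (𝓞 K) in cofinite,
      (∀ w : HeightOneSpectrum (𝓞 L), w.asIdeal.under (𝓞 K) = v.asIdeal →
        w.asIdeal.inertiaDeg (𝓞 K) ≠ 1) ∧
      ∀ α : Multiset ℂ, π.HasSatakeParamAt v α → α.sum ≠ 0)
    (ρ' : FramedGaloisRep L (PadicAlgCl ℓ) n)
    (hρ' : ∀ᶠ w : HeightOneSpectrum (𝓞 L) in cofinite, SatakeFrobCompatibleAt ι P ρ' w) :
    ρ'.toGaloisRep.IsIrreducible :=
  isIrreducible_of_isWeakBaseChangeLiftAE_prime hp ι π P hBC ρ₀ hirr₀ h₀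
    (htr.mono fun _ hv => ⟨hv.1, fun α hα _ _ hζ1 hinv =>
      hv.2 α hα (Multiset.sum_eq_zero_of_map_mul_eq α hζ1 hinv)⟩) ρ' hρ'

end Prime

end Summit.Langlands.Langlands.Theorems.IrreducibleOffSector

end
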